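import Literature.AnabelianGeometry.EtaleTheta.Discharge.Sec2ThetaGroupCommutators
import Literature.Topology.FourManifolds.SurfaceGroupNotProjective
import HarnessLib

/-!
# [EtTh] Prop 2.12 (i) over the §1 setting: the `⊆` half of `hcomm` for the covering `X̲̲`
# (proof-only companion; abc-iut-L2-t10's hypothesis `hcomm`, item N8)

Mochizuki, *The étale theta function and its Frobenioid-theoretic manifestations*, Publ. RIMS **45**
(2009) [EtTh], §2 Prop. 2.12 (i), PRIMS PDF p. 45 (locators `p.N` = PDF pages; bib key
`MochizukiEtTh2009`): "`(l·Δ_Θ)[μ_N]` … coincides with the image of the tautological section of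
`(l·Δ_Θ)[μ_N] ↠ l·Δ_Θ`" — "it follows from the well-known structure of the theta-group"; §1
pp. 12–13: "(Δ^tp_Y)^Θ … abelian profinite".  Layer L2 of the abc-iut cell, item N8 of
abc-iut-L2-t8's adapter report (= the hypothesis `hcomm` of abc-iut-L2-t10's
`RigidData.prop214_i_of_commutators`, `Discharge/Sec2SymmetryProofs.lean`), seat abc-iut-L5-t14
(cross-layer).  PROOF-ONLY continuation of `Sec2ThetaGroupCommutators.lean`.

MAIN RESULT `ThetaSetting.EtaleThetaData.DoubleUnderline.exists_commutator_of_toTheta_mem_lDeltaTheta`: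
for `C : E.DoubleUnderline l` (the covering `X̲̲`, `DoubleUnderline.lean`), assuming `D.IsEtThOrigin`
("`Δ_X` is a profinite free group on 2 generators", p. 12) and the p. 12–13 sentence "(Δ^tp_Y)^Θ is
an abelian profinite group" (hypotheses `hYab`, `hYcl` as in the companion file), every
`t ∈ Π^tp_X̲̲` with `θ t ∈ l·Δ_Θ` is `t = z b z⁻¹ b⁻¹ k` with `z ∈ Π^tp_X̲̲ ∩ Δ^tp_X`,
`b ∈ Π^tp_X̲̲ ∩ Π^tp_Y ∩ Δ^tp_X`, `k ∈ Π^tp_X̲̲ ∩ Ker θ` — the `⊆` half of `hcomm` for the §1 model (the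
`⊇` half is abc-iut-L2-t8's `commutator_mem_comap_lDeltaTheta`).  Ingredients proved here:
`exists_mem_deltaTemp_toZ_eq` (a `z₀ ∈ Δ^tp_X̲̲` over the generator `l ∈ l·Z = Gal(Y̲̲/X̲̲)`),
`relIndex_Huu_dtpY` (`[Δ^tp_Y : Δ^tp_Y̲̲] = l`), and the `l`-bookkeeping: one finite Heisenberg quotient
`Δ_X → H(ℤ/l) = E_f` (the tree's `CocycleExtension` of `(ℤ/l)²` by `ℤ/l`) shows
`[θ⁻¹(Δ_Θ) : θ⁻¹(Δ_Θ) ∩ Π^tp_X̲̲] ≥ l`, whence `Δ^tp_Y = Δ^tp_Y̲̲ · θ⁻¹(Δ_Θ)`.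
HONEST FRAMING: [EtTh] is refereed; the setting is data quoting print, not asserted to exist;
nothing here takes a side on any disputed claim; the two p. 12–13 hypotheses are not discharged here.
-/

noncomputable section

namespace Literature.AnabelianGeometry.EtaleTheta

open Literature.AnabelianGeometry.SemiGraphs Literature.Algebra.Homology Literature.Topology.FourManifolds
open _root_.Topology
open scoped commutatorElement
open ClassTwo

section Algebra

variable {G : Type*} [Group G]

/-- `[Z ^ n, Y] = [Z, Y] ^ n` when `[Z, Y]` commutes with `Z`. Private helper.
[folklore] -/
private theorem commutatorElement_pow_left_of_commute {Z Y : G} (hc : Commute Z ⁅Z, Y⁆) (n : ℕ) :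
    ⁅Z ^ n, Y⁆ = ⁅Z, Y⁆ ^ n := by
  induction n with
  | zero => rw [pow_zero, pow_zero, commutatorElement_one_left]
  | succ n ih =>
    have hid : (⁅Z * Z ^ n, Y⁆ : G) = Z * ⁅Z ^ n, Y⁆ * Z⁻¹ * ⁅Z, Y⁆ := by
      simp only [commutatorElement_def]; group
    rw [pow_succ', hid, ih, (hc.pow_right n).eq, mul_inv_cancel_right, ← pow_succ]

/-- `[Z ^ n * Y₀, Y] = [Z, Y] ^ n` when `Y₀` commutes with `Y` and `[Z, Y]` with `Z`. Private
helper. [folklore] -/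
private theorem commutatorElement_pow_mul_left {Z Y Y₀ : G} (hY : Commute Y₀ Y)
    (hc : Commute Z ⁅Z, Y⁆) (n : ℕ) : ⁅Z ^ n * Y₀, Y⁆ = ⁅Z, Y⁆ ^ n := by
  rw [← commutatorElement_pow_left_of_commute hc n]
  simp only [commutatorElement_def]
  rw [mul_inv_rev, show Z ^ n * Y₀ * Y * (Y₀⁻¹ * (Z ^ n)⁻¹) =
    Z ^ n * (Y₀ * Y * Y₀⁻¹) * (Z ^ n)⁻¹ by group, hY.eq, mul_inv_cancel_right]

end Algebra

namespace ThetaSetting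

variable {p : ℕ} [Fact p.Prime] (D : ThetaSetting p)

/-! ### The covering `X̲̲`: the `⊆` half of `hcomm` -/

namespace EtaleThetaData.DoubleUnderline

variable {D}
variable {E : D.EtaleThetaData} {l : ℕ} (C : E.DoubleUnderline l)

/-- `Δ^tp_X̲̲ ↠ Gal(Y̲̲/X̲̲) ≅ l·Z`: some `z₀ ∈ Π^tp_X̲̲ ∩ Δ^tp_X` has `toZ z₀ = l` (from "`Y̲̲ → Y` of degree
`l`" / `map_toZ_Huu` and "`Π^tp_Ÿ̲̲ ↠ G_K`" / `map_aug_Ydduu`, pp. 41, 37).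
[cite: MochizukiEtTh2009, Def 2.13 (i) p.47] -/
theorem exists_mem_deltaTemp_toZ_eq :
    ∃ z₀ ∈ C.Huu, z₀ ∈ D.DeltaTemp ∧ D.toZ z₀ = Multiplicative.ofAdd (l : ℤ) := by
  have hmem : Multiplicative.ofAdd (l : ℤ) ∈ C.Huu.map D.toZ := by
    rw [C.map_toZ_Huu]; exact Subgroup.mem_zpowers _
  obtain ⟨h₀, hh₀, h₀eq⟩ := hmem
  have haug : D.aug.toMonoidHom h₀ ∈ (D.GtpYdd ⊓ C.Huu).map D.aug.toMonoidHom := by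
    rw [C.map_aug_Ydduu]; exact D.aug_mem_GK h₀
  obtain ⟨y₁, ⟨hy₁Y, hy₁H⟩, hy₁eq⟩ := haug
  refine ⟨h₀ * y₁⁻¹, C.Huu.mul_mem hh₀ (C.Huu.inv_mem hy₁H), ?_, ?_⟩
  · change h₀ * y₁⁻¹ ∈ D.aug.toMonoidHom.ker
    rw [MonoidHom.mem_ker, map_mul, map_inv, ← hy₁eq, mul_inv_cancel]
  · have hy₁Z : D.toZ y₁ = 1 := D.GtpYdd_le_GtpY hy₁Y
    rw [map_mul, map_inv, hy₁Z, inv_one, mul_one, h₀eq]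

/-- `[Δ^tp_Y : Δ^tp_Y̲̲] = l`: the degree-`l` covering `Y̲̲ → Y` (`relIndex_Huu_GtpY`) stays of degree
`l` on geometric fundamental groups, because `Π^tp_Ÿ̲̲` (hence `Π^tp_Y̲̲`) still surjects onto `G_K`
(`map_aug_Ydduu`). [cite: MochizukiEtTh2009, Def 2.7 p.41] -/
theorem relIndex_Huu_dtpY : (C.Huu ⊓ D.DtpY).relIndex D.DtpY = l := by
  haveI : D.DtpY.Normal := by
    change (D.toZ.ker ⊓ D.aug.toMonoidHom.ker).Normal
    exact Subgroup.normal_inf_normal _ _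
  -- `Π^tp_Y = (Π^tp_X̲̲ ∩ Π^tp_Y) · Δ^tp_Y`
  have hsup : (C.Huu ⊓ D.GtpY) ⊔ D.DtpY = D.GtpY := by
    refine le_antisymm (sup_le inf_le_right inf_le_left) fun g hg => ?_
    have haug : D.aug.toMonoidHom g ∈ (D.GtpYdd ⊓ C.Huu).map D.aug.toMonoidHom := by
      rw [C.map_aug_Ydduu]; exact D.aug_mem_GK g
    obtain ⟨y₁, ⟨hy₁Y, hy₁H⟩, hy₁eq⟩ := haug
    rw [show g = y₁ * (y₁⁻¹ * g) from (mul_inv_cancel_left _ _).symm]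
    refine Subgroup.mul_mem_sup ⟨hy₁H, D.GtpYdd_le_GtpY hy₁Y⟩ ⟨?_, ?_⟩
    · exact D.GtpY.mul_mem (D.GtpY.inv_mem (D.GtpYdd_le_GtpY hy₁Y)) hg
    · change y₁⁻¹ * g ∈ D.aug.toMonoidHom.ker
      rw [MonoidHom.mem_ker, map_mul, map_inv, hy₁eq, inv_mul_cancel]
  have hinf : (C.Huu ⊓ D.GtpY) ⊓ D.DtpY = C.Huu ⊓ D.DtpY :=
    Subgroup.ext fun x => ⟨fun ⟨⟨h1, _⟩, h3⟩ => ⟨h1, h3⟩, fun ⟨h1, h3⟩ => ⟨⟨h1, h3.1⟩, h3⟩⟩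
  calc (C.Huu ⊓ D.DtpY).relIndex D.DtpY
      = ((C.Huu ⊓ D.GtpY) ⊓ D.DtpY).relIndex D.DtpY := by rw [hinf]
    _ = (C.Huu ⊓ D.GtpY).relIndex D.DtpY := Subgroup.inf_relIndex_right _ _
    _ = (C.Huu ⊓ D.GtpY).relIndex ((C.Huu ⊓ D.GtpY) ⊔ D.DtpY) :=
        (relIndex_sup_eq_relIndex _ _).symm
    _ = (C.Huu ⊓ D.GtpY).relIndex D.GtpY := by rw [hsup]
    _ = l := C.relIndex_Huu_GtpY

/-- **The `⊆` half of abc-iut-L2-t10's `hcomm` over the §1 setting** ([EtTh] Prop. 2.12 (i), p. 45: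
"`(l·Δ_Θ)[μ_N]` … coincides with the image of the tautological section of `(l·Δ_Θ)[μ_N] ↠ l·Δ_Θ`",
via "the well-known structure of the theta-group"): assume `Δ_X` is free profinite on two
generators (`IsEtThOrigin`) and `(Δ^tp_Y)^Θ` is an abelian profinite group (`hYab`, `hYcl`, pp. 12–13).
Then every `t ∈ Π^tp_X̲̲` whose image in `(Π^tp_X)^Θ` lies in `l·Δ_Θ` is
`t = z b z⁻¹ b⁻¹ k` with `z ∈ Δ^tp_X̲̲ = Π^tp_X̲̲ ∩ Δ^tp_X`, `b ∈ Δ^tp_Y̲̲ = Π^tp_X̲̲ ∩ Π^tp_Y ∩ Δ^tp_X` and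
`k ∈ Ker(Π^tp_X̲̲ → (Π^tp_X)^Θ)`.  (Proof: `z = z₀` with `toZ z₀ = l`; `θ[z₀, y] = θ[z₁, y]^l` sweeps
`l·Δ_Θ` as `y` ranges over `Δ^tp_Y` by the Heisenberg surjectivity; `Δ^tp_Y = Δ^tp_Y̲̲ · θ⁻¹(Δ_Θ)`
because `[Δ^tp_Y : Δ^tp_Y̲̲] = l`, `θ(Π^tp_X̲̲) ∩ Δ_Θ = l·Δ_Θ` and `[Δ_Θ : l·Δ_Θ] ≥ l` — the last from
one finite Heisenberg quotient `Δ_X → H(ℤ/lℤ)`; and `θ[z₀, θ⁻¹(Δ_Θ)] = 1`.)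
[cite: MochizukiEtTh2009, Prop 2.12 (i) p.45] -/
theorem exists_commutator_of_toTheta_mem_lDeltaTheta (hO : D.IsEtThOrigin)
    (hYab : ∀ x ∈ D.DtpYTheta, ∀ y ∈ D.DtpYTheta, x * y = y * x)
    (hYcl : (D.DtpY.map D.toHat.toMonoidHom).topologicalClosure ≤
      D.DtpY.map D.toHat.toMonoidHom ⊔ (⁅⁅D.DeltaHat, D.DeltaHat⁆, D.DeltaHat⁆).topologicalClosure)
    {t : D.PiTemp} (htH : t ∈ C.Huu) (ht : D.toTheta t ∈ D.lDeltaTheta l) :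
    ∃ z ∈ C.Huu, ∃ b ∈ C.Huu, ∃ k ∈ C.Huu, z ∈ D.DeltaTemp ∧ b ∈ D.GtpY ∧ b ∈ D.DeltaTemp ∧
      D.toTheta k = 1 ∧ t = z * b * z⁻¹ * b⁻¹ * k := by
  haveI : NeZero l := ⟨C.l_ne_zero⟩
  haveI hΔn : D.DeltaHat.Normal := SettingCompletion.deltaHat_normal D.toTemperedCurve
  haveI hK₃n : (⁅⁅D.DeltaHat, D.DeltaHat⁆, D.DeltaHat⁆).topologicalClosure.Normal :=
    Subgroup.is_normal_topologicalClosure _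
  obtain ⟨z₀, hz₀H, hz₀Δ, hz₀Z⟩ := C.exists_mem_deltaTemp_toZ_eq
  obtain ⟨⟨z₁, hz₁Δ⟩, hz₁Z'⟩ := D.toZ_delta_surjective (Multiplicative.ofAdd 1)
  have hz₁Z : D.toZ z₁ = Multiplicative.ofAdd 1 := hz₁Z'
  -- `θ t = s ^ l`, `s ∈ Δ_Θ`, `s = θ[z₁, y]`
  obtain ⟨s, hs, hst⟩ := ht
  obtain ⟨y, hy, hys⟩ := D.exists_commutator_of_mem_deltaTheta hYab hYcl hz₁Δ hz₁Z hs
  -- `θ[z₀, y] = s ^ l`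
  have hy₀ : (z₁ ^ l)⁻¹ * z₀ ∈ D.DtpY := by
    refine ⟨?_, D.DeltaTemp.mul_mem (D.DeltaTemp.inv_mem (D.DeltaTemp.pow_mem hz₁Δ _)) hz₀Δ⟩
    change (z₁ ^ l)⁻¹ * z₀ ∈ D.toZ.ker
    rw [MonoidHom.mem_ker, map_mul, map_inv, map_pow, hz₁Z, hz₀Z, ← ofAdd_nsmul, nsmul_one,
      inv_mul_cancel]
  have hz₀y : D.toTheta (z₀ * y * z₀⁻¹ * y⁻¹) = s ^ l := by
    have hz₀eq : z₀ = z₁ ^ l * ((z₁ ^ l)⁻¹ * z₀) := (mul_inv_cancel_left _ _).symm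
    have hY₀Y : Commute (D.toTheta ((z₁ ^ l)⁻¹ * z₀)) (D.toTheta y) :=
      hYab _ ⟨_, hy₀, rfl⟩ _ ⟨y, hy, rfl⟩
    have hsZ : Commute (D.toTheta z₁) ⁅D.toTheta z₁, D.toTheta y⁆ := by
      rw [← map_commutatorElement, commutatorElement_def, hys]
      exact (D.ker_thetaToEll_central s hs _ ⟨z₁, hz₁Δ, rfl⟩).symm
    rw [← commutatorElement_def, map_commutatorElement, hz₀eq, map_mul, map_pow,
      commutatorElement_pow_mul_left hY₀Y hsZ, ← map_commutatorElement, commutatorElement_def, hys]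
  -- `DΘ := θ⁻¹(Δ_Θ) ≤ Δ^tp_Y`, normal
  have hDΘ_le : D.DeltaTheta.comap D.toTheta ≤ D.DtpY := fun d hd =>
    ⟨D.ker_toEll_le_GtpY hd, D.ker_toEll_le_deltaTemp hd⟩
  -- (a) `[Δ^tp_Y̲̲ · DΘ : Δ^tp_Y̲̲] = [DΘ : Δ^tp_Y̲̲ ∩ DΘ] ≥ l`, via a finite Heisenberg quotient
  have hrel : l ≤ (C.Huu ⊓ D.DtpY).relIndex (D.DeltaTheta.comap D.toTheta) := by
    -- the Heisenberg group `H(ℤ/l)` as a cocycle extension of `(ℤ/l)²` by `ℤ/l`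
    let B : (ZMod l × ZMod l) →+ (ZMod l × ZMod l) →+ ZMod l :=
      { toFun := fun v =>
          { toFun := fun w => v.1 * w.2
            map_zero' := by simp
            map_add' := fun w w' => by simp only [Prod.snd_add, mul_add] }
        map_zero' := AddMonoidHom.ext fun w => by simp
        map_add' := fun v v' => AddMonoidHom.ext fun w => by
          simp only [AddMonoidHom.coe_mk, ZeroHom.coe_mk, AddMonoidHom.add_apply, Prod.fst_add,
            add_mul] }
    obtain ⟨f, hf⟩ := exists_cocycles₂_of_biadditive B
    haveI : Finite (Rep.trivial (ZMod l) (Multiplicative (ZMod l × ZMod l)) (ZMod l)) :=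
      inferInstanceAs (Finite (ZMod l))
    obtain ⟨F, a, b, hFa, hFb, hF2, hF3⟩ := hO.exists_hom_finite
      (CocycleExtension f)
      ⟨0, Multiplicative.ofAdd (1, 0)⟩ ⟨0, Multiplicative.ofAdd (0, 1)⟩
    -- structure of `E_f`: commutators are central of exponent `l`
    have hQ1 : ∀ q ∈ (⁅(⊤ : Subgroup (CocycleExtension f)), (⊤ : Subgroup (CocycleExtension f))⁆ :
        Subgroup (CocycleExtension f)), ∃ c, q = CocycleExtension.inl f c := by
      intro q hq
      have hle : (⁅(⊤ : Subgroup (CocycleExtension f)), (⊤ : Subgroup (CocycleExtension f))⁆ :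
          Subgroup (CocycleExtension f)) ≤ (CocycleExtension.rightHom f).ker := by
        rw [← commutator_def]
        exact Abelianization.commutator_subset_ker _
      have hq' := hle hq
      rw [← CocycleExtension.range_inl_eq_ker_rightHom] at hq'
      obtain ⟨c, hc⟩ := hq'
      exact ⟨c, hc.symm⟩
    have hcentral : ∀ (c) (q : CocycleExtension f),
        Commute (CocycleExtension.inl f c) q := by
      intro c q
      have h := CocycleExtension.mul_inl_mul_inv f q c.toAdd
      rw [Rep.trivial_ρ_apply, ofAdd_toAdd] at h
      exact (mul_inv_eq_iff_eq_mul.mp h).symm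
    have hQ3 : ∀ q ∈ (⁅⁅(⊤ : Subgroup (CocycleExtension f)), (⊤ : Subgroup (CocycleExtension f))⁆,
        (⊤ : Subgroup (CocycleExtension f))⁆ : Subgroup (CocycleExtension f)), q = 1 := by
      have hle : (⁅⁅(⊤ : Subgroup (CocycleExtension f)), (⊤ : Subgroup (CocycleExtension f))⁆,
          (⊤ : Subgroup (CocycleExtension f))⁆ : Subgroup (CocycleExtension f)) ≤ ⊥ := by
        refine Subgroup.commutator_le.mpr fun c hc q _ => ?_
        obtain ⟨c₀, rfl⟩ := hQ1 c hc
        rw [Subgroup.mem_bot, commutatorElement_eq_one_iff_commute]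
        exact hcentral c₀ q
      exact fun q hq => (Subgroup.mem_bot).mp (hle hq)
    have hQ2 : ∀ q ∈ (⁅(⊤ : Subgroup (CocycleExtension f)), (⊤ : Subgroup (CocycleExtension f))⁆ :
        Subgroup (CocycleExtension f)), q ^ l = 1 := by
      intro q hq
      obtain ⟨c, rfl⟩ := hQ1 q hq
      rw [← map_pow, ← ofAdd_toAdd c, ← ofAdd_nsmul, nsmul_eq_mul, ZMod.natCast_self, zero_mul,
        ofAdd_zero, map_one]
    have horder : orderOf (⁅(⟨0, Multiplicative.ofAdd (1, 0)⟩ : CocycleExtension f),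
        (⟨0, Multiplicative.ofAdd (0, 1)⟩ : CocycleExtension f)⁆) = l := by
      rw [commutatorElement_def,
        CocycleExtension.commutator_eq_inl_of_trivial f _ _
          (Commute.all _ _), hf, hf]
      simp only [toAdd_ofAdd, B, AddMonoidHom.coe_mk, ZeroHom.coe_mk, mul_one, mul_zero, sub_zero]
      rw [orderOf_injective _ (CocycleExtension.inl_injective f),
        orderOf_ofAdd_eq_addOrderOf, ZMod.addOrderOf_one]
    -- the homomorphism `g : DΘ → E_f`, `d ↦ F (ι d)`
    have hDΘΔ : D.DeltaTheta.comap D.toTheta ≤ D.DeltaTemp := fun d hd => (hDΘ_le hd).2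
    let g : (D.DeltaTheta.comap D.toTheta) →* CocycleExtension f :=
      F.comp (D.deltaToHat.toMonoidHom.comp (Subgroup.inclusion hDΘΔ))
    have hg : ∀ d : D.DeltaTheta.comap D.toTheta,
        g d = F ⟨D.toHat d, Subgroup.le_topologicalClosure _ ⟨d, hDΘΔ d.2, rfl⟩⟩ := fun d => rfl
    -- `g` kills `Π^tp_X̲̲ ∩ DΘ`: `θ h = s₁^l`, `h = d₁^l k`, `F(ι d₁) ∈ [E,E]` has exponent `l`,
    -- `F(ι k) ∈ [[E,E],E] = 1`
    have hker : (C.Huu ⊓ D.DtpY).subgroupOf (D.DeltaTheta.comap D.toTheta) ≤ g.ker := by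
      intro h hh
      rw [Subgroup.mem_subgroupOf] at hh
      have hθh : D.toTheta (h : D.PiTemp) ∈ C.Huu.map D.toTheta ⊓ D.DeltaTheta :=
        ⟨⟨h, hh.1, rfl⟩, h.2⟩
      rw [C.map_toTheta_Huu] at hθh
      obtain ⟨s₁, hs₁, hs₁h⟩ := hθh
      obtain ⟨d₁, rfl⟩ := D.toTheta_surjective s₁
      have hd₁ : d₁ ∈ D.DeltaTheta.comap D.toTheta := hs₁
      have hk : (d₁ ^ l)⁻¹ * (h : D.PiTemp) ∈ D.toTheta.ker := by
        rw [MonoidHom.mem_ker, map_mul, map_inv, map_pow, hs₁h, inv_mul_cancel]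
      have hkD : (d₁ ^ l)⁻¹ * (h : D.PiTemp) ∈ D.DeltaTheta.comap D.toTheta := by
        rw [Subgroup.mem_comap, (MonoidHom.mem_ker).mp hk]; exact one_mem _
      have hheq : h = ⟨d₁, hd₁⟩ ^ l * ⟨_, hkD⟩ := Subtype.ext (mul_inv_cancel_left _ _).symm
      rw [MonoidHom.mem_ker, hheq, map_mul, map_pow, hg, hg]
      have h1 : F ⟨D.toHat d₁, Subgroup.le_topologicalClosure _ ⟨d₁, hDΘΔ hd₁, rfl⟩⟩ ^ l = 1 := by
        refine hQ2 _ (hF2 _ ?_)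
        have : d₁ ∈ (D.thetaToEll.comp D.toTheta).ker := hd₁
        rw [D.ker_toEll] at this
        exact this
      have h2 : F ⟨D.toHat ((d₁ ^ l)⁻¹ * (h : D.PiTemp)),
          Subgroup.le_topologicalClosure _ ⟨_, hDΘΔ hkD, rfl⟩⟩ = 1 := by
        refine hQ3 _ (hF3 _ ?_)
        rw [D.ker_toTheta] at hk
        exact hk
      rw [h1, h2, one_mul]
    -- `g` hits the commutator `[X, Y]` of order `l`: `[a, b] ≡ ι[z₁, y']` modulo `K₃`
    have hab : ((⁅a, b⁆ : D.DeltaHat) : D.PiHat) ∈ (⁅D.DeltaHat, D.DeltaHat⁆).topologicalClosure :=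
      Subgroup.le_topologicalClosure _ (Subgroup.commutator_mem_commutator a.2 b.2)
    obtain ⟨y', hy', k₃, hk₃, habeq⟩ :=
      D.exists_commutator_mul_of_mem_commutatorClosure hYab hYcl hz₁Δ hz₁Z hab
    have hd₀ : z₁ * y' * z₁⁻¹ * y'⁻¹ ∈ D.DeltaTheta.comap D.toTheta := by
      have hk₂ : D.toHat.toMonoidHom (z₁ * y' * z₁⁻¹ * y'⁻¹) ∈
          (⁅D.DeltaHat, D.DeltaHat⁆).topologicalClosure := by
        rw [← commutatorElement_def, map_commutatorElement]
        exact Subgroup.le_topologicalClosure _ (Subgroup.commutator_mem_commutator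
          (Subgroup.le_topologicalClosure _ ⟨z₁, hz₁Δ, rfl⟩)
          (Subgroup.le_topologicalClosure _ ⟨y', hy'.2, rfl⟩))
      have : z₁ * y' * z₁⁻¹ * y'⁻¹ ∈ (D.thetaToEll.comp D.toTheta).ker := by
        rw [D.ker_toEll]; exact hk₂
      exact this
    have hgd₀ : g ⟨_, hd₀⟩ = ⁅(⟨0, Multiplicative.ofAdd (1, 0)⟩ : CocycleExtension f),
        (⟨0, Multiplicative.ofAdd (0, 1)⟩ : CocycleExtension f)⁆ := by
      rw [hg, ← hFa, ← hFb, ← map_commutatorElement]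
      have hk₃' : (⟨k₃, D.tripleCommutatorClosure_le_deltaHat hk₃⟩ : D.DeltaHat) =
          (⟨D.toHat (z₁ * y' * z₁⁻¹ * y'⁻¹), Subgroup.le_topologicalClosure _
            ⟨_, hDΘΔ hd₀, rfl⟩⟩ : D.DeltaHat)⁻¹ * ⁅a, b⁆ := by
        apply Subtype.ext
        change k₃ = (D.toHat.toMonoidHom (z₁ * y' * z₁⁻¹ * y'⁻¹))⁻¹ * ((⁅a, b⁆ : D.DeltaHat) : D.PiHat)
        rw [habeq, inv_mul_cancel_left]
      have hFk₃ : F ⟨k₃, D.tripleCommutatorClosure_le_deltaHat hk₃⟩ = 1 := hQ3 _ (hF3 _ hk₃)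
      rw [hk₃', map_mul, map_inv, inv_mul_eq_one] at hFk₃
      exact hFk₃
    -- index bookkeeping
    have hne : (C.Huu ⊓ D.DtpY).relIndex (D.DeltaTheta.comap D.toTheta) ≠ 0 := fun h0 =>
      C.l_ne_zero (C.relIndex_Huu_dtpY.symm.trans (Subgroup.relIndex_eq_zero_of_le_right hDΘ_le h0))
    have hdvd : l ∣ (C.Huu ⊓ D.DtpY).relIndex (D.DeltaTheta.comap D.toTheta) := by
      change l ∣ ((C.Huu ⊓ D.DtpY).subgroupOf (D.DeltaTheta.comap D.toTheta)).index
      refine dvd_trans ?_ (Subgroup.index_dvd_of_le hker)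
      rw [Subgroup.index_ker]
      have hmem : g ⟨_, hd₀⟩ ∈ g.range := ⟨_, rfl⟩
      have h := orderOf_dvd_natCard (⟨g ⟨_, hd₀⟩, hmem⟩ : g.range)
      have hcoe : orderOf ((⟨g ⟨_, hd₀⟩, hmem⟩ : g.range)) = orderOf (g ⟨_, hd₀⟩) := by
        rw [← orderOf_injective g.range.subtype g.range.subtype_injective]; rfl
      rwa [hcoe, hgd₀, horder] at h
    exact Nat.le_of_dvd (Nat.pos_of_ne_zero hne) hdvd
  -- (b) hence `Δ^tp_Y ≤ Δ^tp_Y̲̲ ⊔ DΘ`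
  have hsup : D.DtpY ≤ (C.Huu ⊓ D.DtpY) ⊔ D.DeltaTheta.comap D.toTheta := by
    have hprod := Subgroup.relIndex_mul_relIndex (C.Huu ⊓ D.DtpY)
      ((C.Huu ⊓ D.DtpY) ⊔ D.DeltaTheta.comap D.toTheta) D.DtpY le_sup_left
      (sup_le inf_le_right hDΘ_le)
    rw [C.relIndex_Huu_dtpY, relIndex_sup_eq_relIndex] at hprod
    refine Subgroup.relIndex_eq_one.mp ?_
    have hl : 0 < l := Nat.pos_of_ne_zero C.l_ne_zero
    generalize ha : (C.Huu ⊓ D.DtpY).relIndex (D.DeltaTheta.comap D.toTheta) = a at hprod hrel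
    generalize hb : ((C.Huu ⊓ D.DtpY) ⊔ D.DeltaTheta.comap D.toTheta).relIndex D.DtpY = b at hprod ⊢
    rcases Nat.lt_or_ge b 2 with hb2 | hb2
    · interval_cases b
      · omega
      · rfl
    · have hmul := Nat.mul_le_mul_left a hb2
      omega
  -- (c) decompose `y = h · d` and finish
  obtain ⟨h, hh, d, hd, hyd⟩ := Subgroup.mem_sup_of_normal_right.mp (hsup hy)
  have hθd : D.toTheta (z₀ * d * z₀⁻¹ * d⁻¹) = 1 := by
    rw [← commutatorElement_def, map_commutatorElement, commutatorElement_eq_one_iff_mul_comm]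
    exact (D.ker_thetaToEll_central _ hd _ ⟨z₀, hz₀Δ, rfl⟩).symm
  have hθh : D.toTheta (z₀ * h * z₀⁻¹ * h⁻¹) = s ^ l := by
    have hid : z₀ * y * z₀⁻¹ * y⁻¹ = z₀ * h * z₀⁻¹ * h⁻¹ * (h * (z₀ * d * z₀⁻¹ * d⁻¹) * h⁻¹) := by
      rw [← hyd]; group
    have h1 : D.toTheta (h * (z₀ * d * z₀⁻¹ * d⁻¹) * h⁻¹) = 1 := by
      rw [map_mul, map_mul, hθd, mul_one, map_inv, mul_inv_cancel]
    rw [← hz₀y, hid, map_mul D.toTheta (z₀ * h * z₀⁻¹ * h⁻¹), h1, mul_one]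
  refine ⟨z₀, hz₀H, h, hh.1, (z₀ * h * z₀⁻¹ * h⁻¹)⁻¹ * t, ?_, hz₀Δ, hh.2.1, hh.2.2, ?_,
    (mul_inv_cancel_left _ _).symm⟩
  · exact C.Huu.mul_mem (C.Huu.inv_mem (C.Huu.mul_mem (C.Huu.mul_mem (C.Huu.mul_mem hz₀H hh.1)
      (C.Huu.inv_mem hz₀H)) (C.Huu.inv_mem hh.1))) htH
  · rw [map_mul, map_inv, hθh, hst, inv_mul_cancel]

end EtaleThetaData.DoubleUnderline

end ThetaSetting

end Literature.AnabelianGeometry.EtaleTheta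

end
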